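import Summits.AtomisticToContinuum.Crystallization.Theses.EnergyDerivativeOrder

/-!
# Route `EnergyDerivativeOrder`, item stmt-AtomisticToContinuum-12285 `Assembly`

The support-level assembly chain of route `AtomisticToContinuum/Crystallization/EnergyDerivativeOrder`:

`DirectionalRobustHcpBound → NondegenerateHcpOptimum → TrialUpperBound → DanskinStep →
SupergradientSandwich → SpectralRigidityHcp → GappedKissingBound → LimitTransfer → Crystallization`.

Pure bookkeeping (self-contained, imports only the route file):

* `DanskinStep` applied to (`DirectionalRobustHcpBound`, `NondegenerateHcpOptimum`,
  `TrialUpperBound`) yields one relaxed hcp crystal `hcpPeriodicConfiguration ha hh` in the window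
  `|h/a - √(2/3)| ≤ 1/400` carrying (i') the energetic conjunct (`IsLeast` among periodic
  configurations, `E(N)/N → e(hcp(a,h))`) and the two one-sided no-corner clauses along every `C²`
  compactly supported `W`; `SupergradientSandwich` at that crystal turns them into (ii'),
  convergence of the `W`-statistics of EVERY sequence of Lennard-Jones ground states;
* `LimitTransfer` fed with `SpectralRigidityHcp` and `GappedKissingBound` is the positional
  transfer;
* conjunct (i) `HasPeriodicGroundStateEnergy lennardJones 3` is (i') verbatim, and conjunct (ii)
  `IsCrystallizing lennardJones 3` is the positional transfer applied with the PROVED uniform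
  minimal distance of Lennard-Jones ground states `LennardJonesMinimalDistance_holds` (`δ = 1/3`)
  and (ii').
-/

namespace Summit.AtomisticToContinuum.Crystallization.Theorems

open Summit.AtomisticToContinuum.Crystallization.Theses.EnergyDerivativeOrder

/-- **Item stmt-AtomisticToContinuum-12285** (`Assembly`, route `EnergyDerivativeOrder`):
`DirectionalRobustHcpBound → NondegenerateHcpOptimum → TrialUpperBound → DanskinStep →
SupergradientSandwich → SpectralRigidityHcp → GappedKissingBound → LimitTransfer → Crystallization`.
`DanskinStep` on the first three hypotheses gives the relaxed hcp crystal with (i') and no corner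
of the ground-state energy along every `C²` bump; `SupergradientSandwich` at that crystal gives the
pair statistics (ii'); (i') is conjunct (i) of `Crystallization` verbatim, and `LimitTransfer` fed
with `SpectralRigidityHcp`, `GappedKissingBound`, the proved uniform minimal distance of
Lennard-Jones ground states and (ii') gives conjunct (ii) `IsCrystallizing lennardJones 3`. -/
theorem energyDerivativeOrder_assembly_proof :
    Summit.AtomisticToContinuum.Crystallization.Theses.EnergyDerivativeOrder.Assembly := by
  unfold Summit.AtomisticToContinuum.Crystallization.Theses.EnergyDerivativeOrder.Assembly
  intro hC1 hC3 hTrial hDanskin hSandwich hC2 hGKB hLT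
  -- the relaxed hcp crystal with (i') and the no-corner clauses (Danskin step)
  obtain ⟨a, h, ha, hh, ha0, hwin, hleast, hlim, hnocorner⟩ := hDanskin hC1 hC3 hTrial
  -- (ii'): pair statistics of every ground-state sequence (supergradient sandwich at hcp(a,h))
  have hstat := hSandwich
    (Literature.MathematicalPhysics.StatisticalMechanics.hcpPeriodicConfiguration ha hh) hnocorner
  -- conjunct (i) `HasPeriodicGroundStateEnergy lennardJones 3` is (i') verbatim
  refine ⟨⟨Literature.MathematicalPhysics.StatisticalMechanics.hcpPeriodicConfiguration ha hh,
    hleast, hlim⟩, ?_⟩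
  -- conjunct (ii) `IsCrystallizing lennardJones 3`: limit transfer fed with C2, the gapped kissing
  -- bound, the proved uniform minimal distance (δ = 1/3) and the pair statistics (ii')
  intro x hx
  obtain ⟨δ, hδ, hsep⟩ :=
    Literature.MathematicalPhysics.StatisticalMechanics.LennardJonesMinimalDistance_holds
  exact hLT hC2 hGKB a h ha hh ha0 hwin x ⟨δ, hδ, fun N i j hij => hsep N (x N) (hx N) i j hij⟩
    (fun W hW hWc => hstat x hx W hW hWc)

end Summit.AtomisticToContinuum.Crystallization.Theorems
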